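import Literature.NumberTheory.Transcendental.NesterenkoElimination
import Mathlib.RingTheory.Nullstellensatz
import Mathlib.LinearAlgebra.Matrix.Adjugate
import Mathlib.LinearAlgebra.Matrix.NonsingularInverse
import Mathlib.LinearAlgebra.Dimension.StrongRankCondition
import Mathlib.FieldTheory.IsAlgClosed.Basic
import HarnessLib

/-!
# The zeros of Nesterenko's inertia forms `Ī(s)` over an ARBITRARY algebraically closed field of characteristic `0` — proofs only

`Literature/NumberTheory/Transcendental/NesterenkoEliminationZerosK.lean`. The tree's
`NesterenkoEliminationZeros.lean` proves the Hauptsatz on the inertia forms of Definition 4.3 of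
Nesterenko–Philippon (eds.), LNM 1752 (2001), Ch. 3 §4 (`Ī(s) = Nesterenko.elimIdeal 𝔓 s`: for a
homogeneous `𝔓 ⊂ ℚ[x₀, …, x_m]` and a specialisation `u⁰` of the generic hyperplanes, some
`G ∈ Ī(s)` has `G(u⁰) ≠ 0` iff the hyperplanes `L_i(u⁰) = 0` have no common zero on `V(𝔓)`) for
COMPLEX points. The height estimates of Prop. 4.11 2)–3) ([Nes10, Prop. 1.4]: at the finite places
the Gauss norms are multiplicative, which is read off at `ℂ_p`-points of the unit polydisc) need the
same statement over other algebraically closed fields (`ℂ_p`, `ℚ̄`), so this file proves it for an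
arbitrary algebraically closed field `K` of characteristic `0` (a `ℚ`-algebra):

* `aeval_eq_zero_of_mem_elimIdeal_of_zero` — a common zero `β̄ ∈ K^{m+1} ∖ 0` of `𝔓` on the
  hyperplanes `L_i(u⁰) = 0` kills every `G ∈ Ī(s)` at `u⁰` (any field `K ⊇ ℚ`);
* `exists_mem_elimIdeal_aeval_ne_zero_of_isAlgClosed` — conversely (`K` algebraically closed), if
  no non-zero `K`-zero of `𝔓` lies on all the hyperplanes, some `G ∈ Ī(s)` has `G(u⁰) ≠ 0`;
* `aeval_chowForm_eq_zero_iff_of_isAlgClosed` — hence for principal `Ī(s)` (Prop. 4.4) the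
  associated form vanishes at `u⁰ ∈ K^{s(m+1)}` iff the hyperplanes have a common zero on `V_K(𝔓)`.

Proof of the hard direction (elementary, as over `ℂ`): Hilbert's Nullstellensatz over `K` (Mathlib)
puts all monomials of some degree `M ≥ 1` in `(𝔓, L_1(u⁰), …, L_s(u⁰)) ⊂ K[x̲]`; comparing
homogeneous components, the degree-`M` products `x^γ p` (`p ∈ 𝔓` homogeneous) and `x^γ L_i(u⁰)`
span `K[x̲]_M`; the same products with GENERIC `L_i` have a coefficient matrix over `ℚ[U]`
specialising to one of full row rank at `u⁰`, so some maximal minor `Δ` has `Δ(u⁰) ≠ 0`, while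
Cramer's rule gives `Δ · x^α ∈ (𝔓, L_1, …, L_s)` for all `|α| = M`, i.e. `Δ ∈ Ī(s)`
(auxiliary linear algebra: `exists_submatrix_isUnit`).

## References

* [NesterenkoPhilippon2001] Yu. V. Nesterenko, P. Philippon (eds.), *Introduction to Algebraic
  Independence Theory*, LNM 1752, Springer 2001, Ch. 3 §4, Def. 4.3, Prop. 4.4 (p. 38), Prop. 4.11
  (pp. 40–41).
* [Nes10] Yu. V. Nesterenko, Proc. Steklov Inst. Math. 218 (1997) 294–331, Prop. 1.4.
* B. L. van der Waerden, *Moderne Algebra* II, §80 (der Trägheitsformen-Hauptsatz).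
-/
noncomputable section

open MvPolynomial Matrix

attribute [local instance] MvPolynomial.gradedAlgebra

namespace Literature.NumberTheory.Transcendental

namespace Nesterenko

variable {m : ℕ}

/-! ### Linear algebra: a spanning family of columns contains an invertible square submatrix -/

/-- If the columns of a (possibly infinite) matrix over a field span the whole space of column
vectors, some square submatrix made of `#rows` of its columns is invertible. [folklore] -/
theorem exists_submatrix_isUnit {K ρ C : Type*} [Field K] [Fintype ρ] [DecidableEq ρ]
    (A : Matrix ρ C K) (h : ⊤ ≤ Submodule.span K (Set.range Aᵀ)) :
    ∃ e : ρ → C, IsUnit (A.submatrix id e) := by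
  classical
  obtain ⟨b, hbsub, hbspan, hbli⟩ := exists_linearIndependent K (Set.range Aᵀ)
  have htop : ⊤ ≤ Submodule.span K (Set.range ((↑) : b → ρ → K)) := by
    rw [Subtype.range_coe_subtype, Set.setOf_mem_eq, hbspan]
    exact h
  let B : Module.Basis b K (ρ → K) := Module.Basis.mk hbli htop
  let ε : ρ ≃ b := (Pi.basisFun K ρ).indexEquiv B
  have hmem : ∀ r : ρ, ((ε r : b) : ρ → K) ∈ Set.range Aᵀ := fun r => hbsub (ε r).2
  choose e he using hmem
  refine ⟨e, Matrix.linearIndependent_cols_iff_isUnit.mp ?_⟩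
  have hcol : (A.submatrix id e).col = fun r => ((ε r : b) : ρ → K) := by
    funext r
    rw [← he r]
    rfl
  rw [hcol]
  exact hbli.comp _ ε.injective

/-! ### Monomials of a fixed degree -/

/-- The exponents of total degree `M` in `m + 1` variables (a finite type). [folklore] -/
abbrev InertiaMonDeg (m M : ℕ) : Type := {α : Fin (m + 1) →₀ ℕ // α.degree = M}

/-- There are finitely many exponents of degree `M` (each coordinate is `≤ M`). [folklore] -/
instance (m M : ℕ) : Fintype (InertiaMonDeg m M) := by
  classical
  refine Fintype.ofInjective (fun α : InertiaMonDeg m M => fun j : Fin (m + 1) =>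
    (⟨α.1 j, Nat.lt_succ_of_le ((Finsupp.le_degree j α.1).trans_eq α.2)⟩ : Fin (M + 1))) ?_
  intro α β h
  apply Subtype.ext
  ext j
  have := congrFun h j
  simpa using this

/-! ### Ideals generated by homogeneous elements are spanned, over the base field, by monomial
multiples of the generators -/

section Span

variable {K : Type*} [Field K] {σ : Type*}

/-- The `K`-span of a set of polynomials that is stable under multiplication by the variables is
(the underlying submodule of) an ideal. [folklore] -/
theorem mul_mem_span_of_X_mul_mem {S : Set (MvPolynomial σ K)}
    (hS : ∀ k, ∀ w ∈ S, X k * w ∈ Submodule.span K S) (a : MvPolynomial σ K)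
    {f : MvPolynomial σ K} (hf : f ∈ Submodule.span K S) : a * f ∈ Submodule.span K S := by
  induction a using MvPolynomial.induction_on generalizing f with
  | C c =>
    rw [C_mul']
    exact Submodule.smul_mem _ c hf
  | add p q hp hq =>
    rw [add_mul]
    exact Submodule.add_mem _ (hp hf) (hq hf)
  | mul_X p k hp =>
    rw [mul_assoc]
    refine hp ?_
    -- `X k * f ∈ span S` for `f ∈ span S`
    refine Submodule.span_induction (p := fun g _ => X k * g ∈ Submodule.span K S) ?_ ?_ ?_ ?_ hf
    · exact fun w hw => hS k w hw
    · simp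
    · intro g g' _ _ hg hg'
      rw [mul_add]
      exact Submodule.add_mem _ hg hg'
    · intro c g _ hg
      rw [mul_smul_comm]
      exact Submodule.smul_mem _ c hg

/-- Hence an ideal generated inside such a set lies in its `K`-span. [folklore] -/
theorem ideal_span_le_span_of_X_mul_mem {S T : Set (MvPolynomial σ K)} (hTS : T ⊆ S)
    (hS : ∀ k, ∀ w ∈ S, X k * w ∈ Submodule.span K S) {f : MvPolynomial σ K}
    (hf : f ∈ Ideal.span T) : f ∈ Submodule.span K S := by
  refine Submodule.span_induction (p := fun g _ => g ∈ Submodule.span K S) ?_ ?_ ?_ ?_ hf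
  · exact fun g hg => Submodule.subset_span (hTS hg)
  · simp
  · intro g g' _ _ hg hg'
    exact Submodule.add_mem _ hg hg'
  · intro a g _ hg
    rw [smul_eq_mul]
    exact mul_mem_span_of_X_mul_mem hS a hg

end Span

/-! ### The easy direction: a common zero kills `Ī(s)` -/

/-- **If the hyperplanes `L_i(u⁰) = 0` have a common zero `β̄ ∈ V_K(𝔓)` (`β̄ ∈ K^{m+1} ∖ 0`,
`K ⊇ ℚ` any field), every `G ∈ Ī(s)` vanishes at `u⁰`**: substitute `U = u⁰`, `x̲ = β̄` in
`G x_j^M ∈ (𝔓, L_1, …, L_s)` for a `j` with `β_j ≠ 0`.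
[cite: NesterenkoPhilippon2001, Ch. 3 Def. 4.3 (p. 38)] -/
theorem aeval_eq_zero_of_mem_elimIdeal_of_zero {K : Type*} [Field K] [Algebra ℚ K]
    {𝔓 : Ideal (Rx m)} {s : ℕ} {G : RU s m}
    (hG : G ∈ elimIdeal 𝔓 s) {u : Fin s × Fin (m + 1) → K} {β : Fin (m + 1) → K} (hβ0 : β ≠ 0)
    (hβI : ∀ P ∈ 𝔓, aeval β P = 0) (hL : ∀ i : Fin s, ∑ j, u (i, j) * β j = 0) :
    aeval u G = 0 := by
  obtain ⟨M, -, hM⟩ := hG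
  obtain ⟨j, hj⟩ := Function.ne_iff.mp hβ0
  set ev : RUX s m →ₐ[ℚ] K := aeval (Sum.elim u β) with hev
  have ev_inl : ∀ G : RU s m, ev (rename Sum.inl G) = aeval u G := fun G => by
    rw [hev, aeval_rename]; rfl
  have ev_inr : ∀ P : Rx m, ev (rename Sum.inr P) = aeval β P := fun P => by
    rw [hev, aeval_rename]; rfl
  have hker : extIdeal 𝔓 s ≤ RingHom.ker ev := by
    refine sup_le ?_ ?_
    · rw [Ideal.map_le_iff_le_comap]
      intro P hP
      rw [Ideal.mem_comap, RingHom.mem_ker, ev_inr, hβI P hP]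
    · rw [Ideal.span_le]
      rintro _ ⟨i, rfl⟩
      rw [SetLike.mem_coe, RingHom.mem_ker]
      simp only [linForm, map_sum, map_mul, hev, aeval_X, Sum.elim_inl, Sum.elim_inr]
      exact hL i
  have h := hker (hM j)
  rw [RingHom.mem_ker, map_mul, map_pow, ev_inl] at h
  have hX : ev (X (Sum.inr j)) = β j := by rw [hev, aeval_X, Sum.elim_inr]
  rw [hX] at h
  exact (mul_eq_zero.mp h).resolve_right (pow_ne_zero _ hj)

/-! ### The hard direction: no common zero produces an inertia form non-zero at `u⁰` -/

section Hauptsatz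

variable {K : Type*} [Field K] [Algebra ℚ K] (𝔓 : Ideal (Rx m)) (s : ℕ)

/-- Column indices: a homogeneous element `p ∈ 𝔓` (of recorded degree `b`) together with a monomial
`x^γ`, or a generic linear form `L_i` together with a monomial `x^γ`. [folklore] -/
abbrev InertiaColIdx : Type :=
  ((Σ b : ℕ, {p : Rx m // p ∈ 𝔓 ∧ p.IsHomogeneous b}) × (Fin (m + 1) →₀ ℕ)) ⊕
    (Fin s × (Fin (m + 1) →₀ ℕ))

variable {𝔓 s}

/-- The degree of the column `x^γ p`, resp. `x^γ L_i`. [folklore] -/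
def inertiaColDeg : InertiaColIdx 𝔓 s → ℕ
  | Sum.inl (bp, γ) => bp.1 + γ.degree
  | Sum.inr (_, γ) => γ.degree + 1

/-- Shifting a column index by the variable `x_k`. [folklore] -/
def inertiaColShift (k : Fin (m + 1)) : InertiaColIdx 𝔓 s → InertiaColIdx 𝔓 s
  | Sum.inl (bp, γ) => Sum.inl (bp, γ + Finsupp.single k 1)
  | Sum.inr (i, γ) => Sum.inr (i, γ + Finsupp.single k 1)

/-- The generic linear form `L_i = ∑_j u_{ij} x_j` as a polynomial in `x̲` over `ℚ[U]`. [folklore] -/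
def inertiaGenLin (i : Fin s) : MvPolynomial (Fin (m + 1)) (RU s m) :=
  ∑ j : Fin (m + 1), C (X (i, j)) * X j

/-- The specialised linear form `L_i(u⁰) = ∑_j u⁰_{ij} x_j ∈ K[x̲]`. [folklore] -/
def inertiaSpecLin (u : Fin s × Fin (m + 1) → K) (i : Fin s) : MvPolynomial (Fin (m + 1)) K :=
  ∑ j : Fin (m + 1), C (u (i, j)) * X j

/-- The generic columns `x^γ p`, `x^γ L_i` in `ℚ[U][x̲]`. [folklore] -/
def inertiaGCol : InertiaColIdx 𝔓 s → MvPolynomial (Fin (m + 1)) (RU s m)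
  | Sum.inl (bp, γ) => monomial γ 1 * map C bp.2.1
  | Sum.inr (i, γ) => monomial γ 1 * inertiaGenLin i

/-- The specialised columns `x^γ p`, `x^γ L_i(u⁰)` in `K[x̲]`. [folklore] -/
def inertiaSCol (u : Fin s × Fin (m + 1) → K) : InertiaColIdx 𝔓 s → MvPolynomial (Fin (m + 1)) K
  | Sum.inl (bp, γ) => monomial γ 1 * map (algebraMap ℚ K) bp.2.1
  | Sum.inr (i, γ) => monomial γ 1 * inertiaSpecLin u i

/-- Specialising `U ↦ u⁰` maps the generic columns to the specialised ones. [folklore] -/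
theorem map_inertiaGCol (u : Fin s × Fin (m + 1) → K) (c : InertiaColIdx 𝔓 s) :
    map (aeval u : RU s m →ₐ[ℚ] K).toRingHom (inertiaGCol c) = inertiaSCol u c := by
  have hC : (aeval u : RU s m →ₐ[ℚ] K).toRingHom.comp C = algebraMap ℚ K := by
    ext a
    simp
  rcases c with ⟨bp, γ⟩ | ⟨i, γ⟩
  · simp only [inertiaGCol, inertiaSCol, map_mul, map_monomial, map_one]
    rw [MvPolynomial.map_map, hC]
  · simp only [inertiaGCol, inertiaSCol, inertiaGenLin, inertiaSpecLin, map_mul, map_monomial, map_one, map_sum, map_C, map_X]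
    congr 1
    refine Finset.sum_congr rfl fun j _ => ?_
    simp

/-- The generic column `c` is homogeneous of degree `inertiaColDeg c`. [folklore] -/
theorem inertiaGCol_isHomogeneous (c : InertiaColIdx 𝔓 s) : (inertiaGCol c).IsHomogeneous (inertiaColDeg c) := by
  rcases c with ⟨⟨b, p⟩, γ⟩ | ⟨i, γ⟩
  · simp only [inertiaGCol, inertiaColDeg]
    rw [Nat.add_comm b]
    exact (isHomogeneous_monomial (σ := Fin (m + 1)) (R := RU s m) (d := γ) 1 rfl).mul
      (p.2.2.map _)
  · simp only [inertiaGCol, inertiaColDeg]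
    refine (isHomogeneous_monomial (σ := Fin (m + 1)) (R := RU s m) (d := γ) 1 rfl).mul ?_
    exact IsHomogeneous.sum _ _ _ fun j _ => isHomogeneous_C_mul_X _ _

/-- The specialised column `c` is homogeneous of degree `inertiaColDeg c`. [folklore] -/
theorem inertiaSCol_isHomogeneous (u : Fin s × Fin (m + 1) → K) (c : InertiaColIdx 𝔓 s) :
    (inertiaSCol u c).IsHomogeneous (inertiaColDeg c) := by
  rw [← map_inertiaGCol]
  exact (inertiaGCol_isHomogeneous c).map _

/-- Multiplying a specialised column by a variable gives the shifted column. [folklore] -/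
theorem X_mul_inertiaSCol (u : Fin s × Fin (m + 1) → K) (k : Fin (m + 1)) (c : InertiaColIdx 𝔓 s) :
    X k * inertiaSCol u c = inertiaSCol u (inertiaColShift k c) := by
  have hmon : ∀ γ : Fin (m + 1) →₀ ℕ, (X k : MvPolynomial (Fin (m + 1)) K) * monomial γ 1 =
      monomial (γ + Finsupp.single k 1) 1 := fun γ => by
    rw [monomial_add_single, pow_one, mul_comm]
  rcases c with ⟨bp, γ⟩ | ⟨i, γ⟩
  · simp only [inertiaSCol, inertiaColShift, ← mul_assoc, hmon]
  · simp only [inertiaSCol, inertiaColShift, ← mul_assoc, hmon]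

/-- The ideal `(𝔓, L_1(u⁰), …, L_s(u⁰)) ⊂ K[x̲]`, generated by the images of the HOMOGENEOUS
elements of `𝔓` and the specialised linear forms. [folklore] -/
def inertiaSpecGens (u : Fin s × Fin (m + 1) → K) : Set (MvPolynomial (Fin (m + 1)) K) :=
  {g | ∃ bp : Σ b : ℕ, {p : Rx m // p ∈ 𝔓 ∧ p.IsHomogeneous b}, g = map (algebraMap ℚ K) bp.2.1} ∪
    Set.range (inertiaSpecLin u)

/-- The generators are (unshifted) specialised columns. [folklore] -/
theorem inertiaSpecGens_subset_range (u : Fin s × Fin (m + 1) → K) :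
    inertiaSpecGens (𝔓 := 𝔓) u ⊆ Set.range (inertiaSCol (𝔓 := 𝔓) u) := by
  rintro g (⟨bp, rfl⟩ | ⟨i, rfl⟩)
  · exact ⟨Sum.inl (bp, 0), by simp [inertiaSCol]⟩
  · exact ⟨Sum.inr (i, 0), by simp [inertiaSCol]⟩

/-- Hence the ideal `(𝔓, L(u⁰))` lies in the `K`-span of all specialised columns. [folklore] -/
theorem mem_span_inertiaSCol_of_mem_ideal_span (u : Fin s × Fin (m + 1) → K)
    {f : MvPolynomial (Fin (m + 1)) K} (hf : f ∈ Ideal.span (inertiaSpecGens (𝔓 := 𝔓) u)) :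
    f ∈ Submodule.span K (Set.range (inertiaSCol (𝔓 := 𝔓) u)) := by
  refine ideal_span_le_span_of_X_mul_mem (inertiaSpecGens_subset_range u) ?_ hf
  rintro k _ ⟨c, rfl⟩
  rw [X_mul_inertiaSCol]
  exact Submodule.subset_span ⟨_, rfl⟩

/-- **Nullstellensatz step.** If no `β̄ ∈ V(𝔓)` lies on all the hyperplanes `L_i(u⁰) = 0`, every
variable has a power in `(𝔓, L(u⁰)) ⊂ K[x̲]`. [folklore] -/
theorem exists_X_pow_mem_ideal_span [IsAlgClosed K]
    (h𝔓 : 𝔓.IsHomogeneous (homogeneousSubmodule (Fin (m + 1)) ℚ))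
    (u : Fin s × Fin (m + 1) → K)
    (h : ∀ β : Fin (m + 1) → K, β ≠ 0 → (∀ P ∈ 𝔓, aeval β P = 0) →
      ∃ i : Fin s, ∑ j, u (i, j) * β j ≠ 0) (k : Fin (m + 1)) :
    ∃ N : ℕ, (X k : MvPolynomial (Fin (m + 1)) K) ^ N ∈ Ideal.span (inertiaSpecGens (𝔓 := 𝔓) u) := by
  have hzero : zeroLocus K (Ideal.span (inertiaSpecGens (𝔓 := 𝔓) u)) ⊆ {0} := by
    intro x hx
    rw [zeroLocus_span] at hx
    by_contra hx0
    -- `x` is a zero of `𝔓` on all the hyperplanes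
    have hxP : ∀ P ∈ 𝔓, aeval x P = 0 := by
      intro P hP
      rw [← sum_homogeneousComponent P, map_sum]
      refine Finset.sum_eq_zero fun n _ => ?_
      have hn : homogeneousComponent n P ∈ 𝔓 := homogeneousComponent_mem_of_mem h𝔓 hP n
      have hg := hx _ (Or.inl ⟨⟨n, ⟨homogeneousComponent n P, hn,
        homogeneousComponent_isHomogeneous n P⟩⟩, rfl⟩)
      rwa [aeval_map_algebraMap] at hg
    obtain ⟨i, hi⟩ := h x hx0 hxP
    apply hi
    have hg := hx _ (Or.inr ⟨i, rfl⟩)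
    simpa [inertiaSpecLin] using hg
  have hXk : (X k : MvPolynomial (Fin (m + 1)) K) ∈
      vanishingIdeal K (zeroLocus K (Ideal.span (inertiaSpecGens (𝔓 := 𝔓) u))) := by
    rw [mem_vanishingIdeal_iff]
    intro x hx
    rw [Set.mem_singleton_iff.mp (hzero hx)]
    simp
  rw [vanishingIdeal_zeroLocus_eq_radical] at hXk
  exact hXk

/-- **Every monomial of a suitable degree `M ≥ 1` lies in the `K`-span of the specialised columns
of degree `M`.** [folklore] -/
theorem exists_forall_monomial_mem_span [IsAlgClosed K]
    (h𝔓 : 𝔓.IsHomogeneous (homogeneousSubmodule (Fin (m + 1)) ℚ))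
    (u : Fin s × Fin (m + 1) → K)
    (h : ∀ β : Fin (m + 1) → K, β ≠ 0 → (∀ P ∈ 𝔓, aeval β P = 0) →
      ∃ i : Fin s, ∑ j, u (i, j) * β j ≠ 0) :
    ∃ M : ℕ, 1 ≤ M ∧ ∀ α : InertiaMonDeg m M, (monomial α.1 (1 : K)) ∈
      Submodule.span K (Set.range
        (fun c : {c : InertiaColIdx 𝔓 s // inertiaColDeg c = M} => inertiaSCol u c.1)) := by
  classical
  choose N hN using exists_X_pow_mem_ideal_span h𝔓 u h
  -- a uniform exponent
  set N₀ : ℕ := Finset.univ.sup N with hN₀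
  have hN₀mem : ∀ k, (X k : MvPolynomial (Fin (m + 1)) K) ^ N₀ ∈
      Ideal.span (inertiaSpecGens (𝔓 := 𝔓) u) := fun k => by
    have hle : N k ≤ N₀ := Finset.le_sup (f := N) (Finset.mem_univ k)
    obtain ⟨d, hd⟩ := Nat.exists_eq_add_of_le hle
    rw [hd, pow_add]
    exact Ideal.mul_mem_right _ _ (hN k)
  refine ⟨(m + 1) * N₀ + 1, Nat.succ_pos _, fun α => ?_⟩
  -- some exponent of `α` is at least `N₀`
  obtain ⟨k, -, hk⟩ : ∃ k ∈ (Finset.univ : Finset (Fin (m + 1))), N₀ ≤ α.1 k := by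
    apply Finset.exists_le_of_sum_le Finset.univ_nonempty
    have hdeg : ∑ k : Fin (m + 1), α.1 k = (m + 1) * N₀ + 1 :=
      (Finsupp.degree_eq_sum α.1).symm.trans α.2
    rw [hdeg]
    simp
  -- so `x^α ∈ (𝔓, L(u⁰))`
  have hαmem : (monomial α.1 (1 : K)) ∈ Ideal.span (inertiaSpecGens (𝔓 := 𝔓) u) := by
    have hsplit : α.1 = (α.1 - Finsupp.single k N₀) + Finsupp.single k N₀ :=
      (tsub_add_cancel_of_le (Finsupp.single_le_iff.mpr hk)).symm
    rw [hsplit, monomial_add_single]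
    exact Ideal.mul_mem_left _ _ (hN₀mem k)
  -- hence in the `K`-span of all columns, and by degrees in that of the columns of degree `M`
  have hspan := mem_span_inertiaSCol_of_mem_ideal_span u hαmem
  have hproj := Submodule.apply_mem_span_image_of_mem_span
    (homogeneousComponent ((m + 1) * N₀ + 1) : MvPolynomial (Fin (m + 1)) K →ₗ[K] _) hspan
  rw [homogeneousComponent_of_mem ((mem_homogeneousSubmodule _ _).mpr
    (isHomogeneous_monomial (R := K) (d := α.1) 1 α.2)), if_pos rfl] at hproj
  have hsub : (homogeneousComponent ((m + 1) * N₀ + 1) : MvPolynomial (Fin (m + 1)) K →ₗ[K] _) ''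
      Set.range (inertiaSCol (𝔓 := 𝔓) u) ⊆
      insert 0 (Set.range (fun c : {c : InertiaColIdx 𝔓 s // inertiaColDeg c = (m + 1) * N₀ + 1} => inertiaSCol u c.1)) := by
    rintro _ ⟨_, ⟨c, rfl⟩, rfl⟩
    rw [homogeneousComponent_of_mem ((mem_homogeneousSubmodule _ _).mpr (inertiaSCol_isHomogeneous u c))]
    split_ifs with hc
    · exact Set.mem_insert_of_mem _ ⟨⟨c, hc.symm⟩, rfl⟩
    · exact Set.mem_insert _ _
  have hmem := Submodule.span_mono hsub hproj
  rwa [Submodule.span_insert_zero] at hmem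

/-- **The Hauptsatz on inertia forms over an algebraically closed field `K ⊇ ℚ`.** If
`𝔓 ⊂ ℚ[x₀, …, x_m]` is homogeneous and the hyperplanes `L_1(u⁰) = 0, …, L_s(u⁰) = 0`
(`u⁰ ∈ K^{s(m+1)}`) have NO common zero on `V_K(𝔓) ⊂ ℙ^m(K)`, then some `G ∈ Ī(s)` does not
vanish at `u⁰`. [cite: NesterenkoPhilippon2001, Ch. 3 Def. 4.3 and the
paragraph after Prop. 4.4 (p. 38)] -/
theorem exists_mem_elimIdeal_aeval_ne_zero_of_isAlgClosed [IsAlgClosed K]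
    (h𝔓 : 𝔓.IsHomogeneous (homogeneousSubmodule (Fin (m + 1)) ℚ))
    (u : Fin s × Fin (m + 1) → K)
    (h : ∀ β : Fin (m + 1) → K, β ≠ 0 → (∀ P ∈ 𝔓, aeval β P = 0) →
      ∃ i : Fin s, ∑ j, u (i, j) * β j ≠ 0) :
    ∃ G ∈ elimIdeal 𝔓 s, aeval u G ≠ 0 := by
  classical
  obtain ⟨M, hM1, hspan⟩ := exists_forall_monomial_mem_span h𝔓 u h
  -- rows: monomials of degree `M`; columns: columns of degree `M`
  let ρ : Type := InertiaMonDeg m M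
  let Cix : Type := {c : InertiaColIdx 𝔓 s // inertiaColDeg c = M}
  let ev : RU s m →+* K := (aeval u : RU s m →ₐ[ℚ] K).toRingHom
  let A : Matrix ρ Cix (RU s m) := fun α c => coeff α.1 (inertiaGCol c.1)
  let A₀ : Matrix ρ Cix K := fun α c => coeff α.1 (inertiaSCol u c.1)
  have hA₀ : A.map ev = A₀ := by
    ext α c
    simp only [A, A₀, Matrix.map_apply]
    rw [← coeff_map, map_inertiaGCol]
  -- the columns of `A₀` span everything
  have hcols : ⊤ ≤ Submodule.span K (Set.range A₀ᵀ) := by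
    let vec : MvPolynomial (Fin (m + 1)) K →ₗ[K] (ρ → K) :=
      LinearMap.pi fun α : ρ => (lcoeff K α.1 : MvPolynomial (Fin (m + 1)) K →ₗ[K] K)
    have hvec_col : ∀ c : Cix, vec (inertiaSCol u c.1) = A₀ᵀ c := fun c => rfl
    have hvec_mon : ∀ α : ρ, vec (monomial α.1 1) = Pi.single α 1 := fun α => by
      funext β
      simp only [vec, LinearMap.pi_apply, lcoeff, LinearMap.coe_mk, AddHom.coe_mk, coeff_monomial]
      by_cases hαβ : α = β
      · subst hαβ; simp
      · rw [if_neg (fun h' => hαβ (Subtype.ext h')), Pi.single_eq_of_ne' hαβ]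
    have hsingle : ∀ α : ρ, (Pi.single α 1 : ρ → K) ∈ Submodule.span K (Set.range A₀ᵀ) := by
      intro α
      rw [← hvec_mon α]
      have h1 := Submodule.apply_mem_span_image_of_mem_span vec (hspan α)
      rw [← Set.range_comp] at h1
      exact h1
    rw [← (Pi.basisFun K ρ).span_eq, Submodule.span_le]
    rintro _ ⟨α, rfl⟩
    rw [Pi.basisFun_apply]
    exact hsingle α
  obtain ⟨e, he⟩ := exists_submatrix_isUnit A₀ hcols
  -- the minor `Δ = det B`, `B = A.submatrix id e`
  let B : Matrix ρ ρ (RU s m) := A.submatrix id e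
  refine ⟨B.det, ⟨M, hM1, fun j => ?_⟩, ?_⟩
  · -- Cramer: `Δ · x^α = ∑_{α'} adj(B)_{α' α} · inertiaGCol (e α')` for `x^α = x_j^M`
    let α : ρ := ⟨Finsupp.single j M, by simp [Finsupp.degree_single]⟩
    let P : MvPolynomial (Fin (m + 1)) (RU s m) :=
      ∑ α' : ρ, C (B.adjugate α' α) * inertiaGCol (e α').1
    have hP : P = monomial α.1 B.det := by
      apply MvPolynomial.ext
      intro β
      simp only [P, coeff_sum, coeff_C_mul, coeff_monomial]
      by_cases hβ : β.degree = M
      · let b : ρ := ⟨β, hβ⟩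
        have hcoeff : ∀ α' : ρ, coeff β (inertiaGCol (e α').1) = B b α' := fun α' => rfl
        simp_rw [hcoeff]
        have hmul : ∑ α' : ρ, B.adjugate α' α * B b α' = (B * B.adjugate) b α := by
          rw [Matrix.mul_apply]
          exact Finset.sum_congr rfl fun α' _ => mul_comm _ _
        rw [hmul, Matrix.mul_adjugate, Matrix.smul_apply, Matrix.one_apply, smul_eq_mul]
        by_cases hbα : b = α
        · rw [if_pos hbα, if_pos (congrArg Subtype.val hbα).symm, mul_one]
        · rw [if_neg hbα, if_neg (fun h' => hbα (Subtype.ext h'.symm)), mul_zero]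
      · have hcoeff : ∀ α' : ρ, coeff β (inertiaGCol (e α').1) = 0 := fun α' =>
          (inertiaGCol_isHomogeneous (e α').1).coeff_eq_zero (by rw [(e α').2]; exact hβ)
        simp_rw [hcoeff, mul_zero, Finset.sum_const_zero]
        rw [if_neg]
        intro h'
        apply hβ
        rw [← h', α.2]
    -- push through `Ψ : ℚ[U][x̲] → ℚ[U, x̲]`
    let Ψ : MvPolynomial (Fin (m + 1)) (RU s m) →+* RUX s m :=
      eval₂Hom (rename Sum.inl : RU s m →ₐ[ℚ] RUX s m).toRingHom fun j => X (Sum.inr j)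
    have hΨC : ∀ G : RU s m, Ψ (C G) = rename Sum.inl G := fun G => eval₂Hom_C _ _ _
    have hΨX : ∀ j, Ψ (X j) = X (Sum.inr j) := fun j => eval₂Hom_X' _ _ _
    have hΨmap : ∀ p : Rx m, Ψ (map C p) = rename Sum.inr p := by
      intro p
      have hcomp : (Ψ.comp (map C)) = (rename Sum.inr : Rx m →ₐ[ℚ] RUX s m).toRingHom := by
        apply MvPolynomial.ringHom_ext
        · intro a
          simp only [RingHom.comp_apply, map_C, hΨC, AlgHom.toRingHom_eq_coe, RingHom.coe_coe,
            rename_C]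
        · intro j
          simp only [RingHom.comp_apply, map_X, hΨX, AlgHom.toRingHom_eq_coe, RingHom.coe_coe,
            rename_X]
      exact RingHom.congr_fun hcomp p
    have hΨlin : ∀ i, Ψ (inertiaGenLin (m := m) i) = linForm s m i := by
      intro i
      simp only [inertiaGenLin, linForm, map_sum, map_mul, hΨC, hΨX, rename_X]
    have hΨcol : ∀ c : InertiaColIdx 𝔓 s, Ψ (inertiaGCol c) ∈ extIdeal 𝔓 s := by
      rintro (⟨bp, γ⟩ | ⟨i, γ⟩)
      · simp only [inertiaGCol, map_mul, hΨmap]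
        exact Ideal.mul_mem_left _ _ (Ideal.mem_sup_left (Ideal.mem_map_of_mem _ bp.2.2.1))
      · simp only [inertiaGCol, map_mul, hΨlin]
        exact Ideal.mul_mem_left _ _ (Ideal.mem_sup_right (Ideal.subset_span ⟨i, rfl⟩))
    have hΨP : Ψ P ∈ extIdeal 𝔓 s := by
      simp only [P, map_sum, map_mul]
      exact Ideal.sum_mem _ fun α' _ => Ideal.mul_mem_left _ _ (hΨcol _)
    rw [hP] at hΨP
    have hmon : Ψ (monomial α.1 B.det) = rename Sum.inl B.det * X (Sum.inr j) ^ M := by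
      change Ψ (monomial (Finsupp.single j M) B.det) = _
      rw [← C_mul_X_pow_eq_monomial, map_mul, map_pow, hΨC, hΨX]
    rwa [hmon] at hΨP
  · -- `Δ(u⁰) = det (A₀.submatrix id e) ≠ 0`
    change ev B.det ≠ 0
    rw [RingHom.map_det]
    have hBmap : ev.mapMatrix B = A₀.submatrix id e := by
      rw [RingHom.mapMatrix_apply, ← hA₀, Matrix.submatrix_map]
    rw [hBmap]
    exact ((Matrix.isUnit_iff_isUnit_det _).mp he).ne_zero

end Hauptsatz

/-! ### The zero set of the associated form -/

/-- **The zeros of the associated form over an algebraically closed field `K ⊇ ℚ`.** Let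
`𝔓 ⊂ ℚ[x₀, …, x_m]` be a homogeneous ideal for which `Ī(s)` is principal (e.g. `𝔓` unmixed of rank
`s`, Prop. 4.4), `F` its generator (the associated form, `chowForm 𝔓 s`) and `u⁰ ∈ K^{s(m+1)}`. Then
`F(u⁰) = 0` if and only if the hyperplanes `L_1(u⁰) = 0, …, L_s(u⁰) = 0` have a common zero
`β̄ ∈ K^{m+1} ∖ 0` on `V_K(𝔓)`.
[cite: NesterenkoPhilippon2001, Ch. 3 Prop. 4.4 and the paragraph after it (p. 38)] -/
theorem aeval_chowForm_eq_zero_iff_of_isAlgClosed {K : Type*} [Field K] [Algebra ℚ K] [IsAlgClosed K]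
    {𝔓 : Ideal (Rx m)} (h𝔓 : 𝔓.IsHomogeneous (homogeneousSubmodule (Fin (m + 1)) ℚ)) {s : ℕ}
    (hpr : (elimIdeal 𝔓 s).IsPrincipal) (u : Fin s × Fin (m + 1) → K) :
    aeval u (chowForm 𝔓 s) = 0 ↔
      ∃ β : Fin (m + 1) → K, β ≠ 0 ∧ (∀ P ∈ 𝔓, aeval β P = 0) ∧
        ∀ i : Fin s, ∑ j, u (i, j) * β j = 0 := by
  constructor
  · intro h0
    by_contra hne
    push Not at hne
    obtain ⟨G, hG, hGu⟩ := exists_mem_elimIdeal_aeval_ne_zero_of_isAlgClosed h𝔓 u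
      fun β hβ0 hβI => hne β hβ0 hβI
    rw [← span_chowForm 𝔓 s hpr, Ideal.mem_span_singleton] at hG
    obtain ⟨H, rfl⟩ := hG
    exact hGu (by rw [map_mul, h0, zero_mul])
  · rintro ⟨β, hβ0, hβI, hL⟩
    have hF : chowForm 𝔓 s ∈ elimIdeal 𝔓 s := by
      rw [← span_chowForm 𝔓 s hpr]
      exact Ideal.mem_span_singleton_self _
    exact aeval_eq_zero_of_mem_elimIdeal_of_zero hF hβ0 hβI hL

/-- In particular, over an algebraically closed `K ⊇ ℚ` in which `𝔓` has a non-zero zero, the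
associated form vanishes at `u⁰ = 0`. [folklore] -/
theorem aeval_zero_chowForm_of_isAlgClosed {K : Type*} [Field K] [Algebra ℚ K] [IsAlgClosed K]
    {𝔓 : Ideal (Rx m)} (h𝔓 : 𝔓.IsHomogeneous (homogeneousSubmodule (Fin (m + 1)) ℚ)) {s : ℕ}
    (hpr : (elimIdeal 𝔓 s).IsPrincipal)
    (hne : ∃ β : Fin (m + 1) → K, β ≠ 0 ∧ ∀ P ∈ 𝔓, aeval β P = 0) :
    aeval (0 : Fin s × Fin (m + 1) → K) (chowForm 𝔓 s) = 0 := by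
  obtain ⟨β, hβ0, hβI⟩ := hne
  exact (aeval_chowForm_eq_zero_iff_of_isAlgClosed h𝔓 hpr 0).mpr ⟨β, hβ0, hβI, fun i => by simp⟩

end Nesterenko

end Literature.NumberTheory.Transcendental

end
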